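import Mathlib
import Summits.ABC.ABC.Statement
import HarnessLib

/-!
# Shape C: the exponent is `1`, `2`, `4` or an odd prime (solo-blind seat, session 5)

Shape C of the first open support is `1 + 2^k p^m = q^n` (`p, q` odd primes).  We prove, WITHOUT Zsigmondy's theorem,
that `n ∈ {1, 2, 4}` or `n` is an odd prime, in which case `q` is a Fermat-type prime `2^s + 1` (and the equation is a
Nagell–Ljunggren equation at that base).  Ingredients: lifting the exponent for an odd prime exponent over an arbitrary odd
base (`pow_odd_prime_corner`), the elementary facts `Q^t - 1 = 2^s ⇒ (Q, t) = (3, 2)` (`t ≥ 2`) and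
`b^(2ℓ) - 1 ≠ 2^k p^m` (`b, ℓ ≥ 3` odd), and `8 ∣ n ⇒ q^n - 1` has two distinct odd prime factors (`(q²+1)/2` and
`(q⁴+1)/2` are odd, coprime and `> 1`).  Together with the kernel corners `n = 2 ⇒ q ∈ {3, 5, 7, 17}` and `n = 4 ⇒ q = 3`
(`SoloBlindOmega3Corners`, `SoloBlindFourthCorner`) this leaves, for shape C, exactly the Nagell–Ljunggren equations at
Fermat-prime bases.

* `pow_odd_prime_corner` : `2^k p^m + 1 = Q^ℓ` (`p, ℓ` odd primes, `Q ≥ 3` odd) ⇒ `p ∤ Q - 1` and `Q = 2^s + 1`.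
* `shapeC_exponent` : `2^k p^m + 1 = q^n` (`p, q` odd primes) ⇒ `n = 1 ∨ n = 2 ∨ n = 4 ∨ (n` odd prime `∧ q = 2^s + 1)`.
-/

namespace Summit.ABC.ABC.Theorems

/-- Parity of a geometric sum with odd ratio: `∑_{i<n} q^i ≡ n (mod 2)`. -/
private theorem geomSum_mod_two {q : ℕ} (hq : Odd q) (n : ℕ) :
    (∑ i ∈ Finset.range n, q ^ i) % 2 = n % 2 := by
  induction n with
  | zero => simp
  | succ n ih =>
    rw [Finset.sum_range_succ, Nat.add_mod, ih]
    have : q ^ n % 2 = 1 := Nat.odd_iff.mp hq.pow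
    rw [this]
    omega

/-- `(q - 1) (1 + q + ⋯ + q^(n-1)) = q^n - 1` in `ℕ`. -/
private theorem geomSum_mul {q : ℕ} (hq : 2 ≤ q) (n : ℕ) :
    (q - 1) * ∑ i ∈ Finset.range n, q ^ i = q ^ n - 1 := by
  rw [Nat.geomSum_eq hq n, Nat.mul_div_cancel' (Nat.sub_one_dvd_pow_sub_one q n)]

/-- An odd number `> 1` dividing `2^k p^m` is divisible by `p`. -/
private theorem dvd_of_odd_dvd_two_pow_mul {W k m p : ℕ} (hp : p.Prime) (hW : W % 2 = 1) (hW1 : 1 < W)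
    (hd : W ∣ 2 ^ k * p ^ m) : p ∣ W := by
  have hdp : W.minFac.Prime := Nat.minFac_prime (by omega)
  have hdW : W.minFac ∣ W := Nat.minFac_dvd W
  rcases (Nat.Prime.dvd_mul hdp).mp (hdW.trans hd) with h2 | hpm
  · have := (Nat.prime_dvd_prime_iff_eq hdp Nat.prime_two).mp (hdp.dvd_of_dvd_pow h2)
    rw [this] at hdW
    exfalso
    omega
  · have := (Nat.prime_dvd_prime_iff_eq hdp hp).mp (hdp.dvd_of_dvd_pow hpm)
    exact this ▸ hdW

/-- **Odd-prime-exponent corner over an arbitrary odd base.** If `p, ℓ` are odd primes, `Q ≥ 3` is odd and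
`2^k p^m + 1 = Q^ℓ`, then `p ∤ Q - 1`, so `Q - 1` is a power of two. -/
theorem pow_odd_prime_corner {k m ℓ p Q : ℕ} (hp : p.Prime) (hℓ : ℓ.Prime) (hp2 : p ≠ 2) (hℓ2 : ℓ ≠ 2)
    (hQ : Odd Q) (hQ3 : 3 ≤ Q) (h : 2 ^ k * p ^ m + 1 = Q ^ ℓ) :
    ¬ p ∣ Q - 1 ∧ ∃ s : ℕ, Q = 2 ^ s + 1 := by
  haveI := Fact.mk hp
  have hp3 : 3 ≤ p := by have := hp.two_le; omega
  have hℓ3 : 3 ≤ ℓ := by have := hℓ.two_le; omega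
  have hQℓ : Q ^ ℓ - 1 = 2 ^ k * p ^ m := by omega
  set Φ := ∑ i ∈ Finset.range ℓ, Q ^ i with hΦdef
  have hΦ : (Q - 1) * Φ = 2 ^ k * p ^ m := by rw [hΦdef, geomSum_mul (by omega), hQℓ]
  have hΦodd : Φ % 2 = 1 := by
    rw [hΦdef, geomSum_mod_two hQ]
    exact Nat.odd_iff.mp (hℓ.odd_of_ne_two hℓ2)
  have hΦbig : Q + 1 ≤ Φ := by
    have : ∑ i ∈ Finset.range 2, Q ^ i ≤ Φ :=
      Finset.sum_le_sum_of_subset (Finset.range_subset_range.mpr (by omega))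
    simpa [Finset.sum_range_succ, add_comm] using this
  have hΦ0 : Φ ≠ 0 := by omega
  have hΦsupp : ∀ d : ℕ, d.Prime → d ∣ Φ → d = p := by
    intro d hd hdΦ
    have : d ∣ 2 ^ k * p ^ m := hΦ ▸ hdΦ.mul_left (Q - 1)
    rcases (Nat.Prime.dvd_mul hd).mp this with h2 | hpm
    · have := (Nat.prime_dvd_prime_iff_eq hd Nat.prime_two).mp (hd.dvd_of_dvd_pow h2)
      subst this
      exfalso
      omega
    · exact (Nat.prime_dvd_prime_iff_eq hd hp).mp (hd.dvd_of_dvd_pow hpm)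
  have hnot : ¬ p ∣ Q - 1 := by
    intro hpQ
    have hpnQ : ¬ p ∣ Q := by
      intro h'
      have h1 : p ∣ (Q - 1) + 1 := by rwa [Nat.sub_add_cancel (by omega : 1 ≤ Q)]
      exact hp.one_lt.ne' (Nat.dvd_one.mp ((Nat.dvd_add_right hpQ).mp h1))
    have hlte := padicValNat.pow_sub_pow (hp.odd_of_ne_two hp2) (show 1 < Q by omega)
      (by simpa using hpQ) hpnQ hℓ.ne_zero
    rw [one_pow, hQℓ] at hlte
    have hv2 : padicValNat p (2 ^ k) = 0 := by
      apply padicValNat.eq_zero_of_not_dvd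
      intro h'
      have := (Nat.prime_dvd_prime_iff_eq hp Nat.prime_two).mp (hp.dvd_of_dvd_pow h')
      omega
    have hvm : padicValNat p (2 ^ k * p ^ m) = m := by
      rw [padicValNat.mul (by positivity) (by positivity), hv2, padicValNat.prime_pow, zero_add]
    have hvℓ : padicValNat p ℓ ≤ 1 := by
      by_cases hpl : p = ℓ
      · subst hpl; rw [padicValNat_self]
      · rw [padicValNat.eq_zero_of_not_dvd]
        · exact zero_le_one
        · intro h'; exact hpl ((Nat.prime_dvd_prime_iff_eq hp hℓ).mp h')
    have hvprod : padicValNat p (Q - 1) + padicValNat p Φ = m := by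
      rw [← padicValNat.mul (by omega) hΦ0, hΦ, hvm]
    obtain ⟨j, hj⟩ : ∃ j, Φ = p ^ j := ⟨_, Nat.eq_prime_pow_of_unique_prime_dvd hΦ0 (hΦsupp _)⟩
    have hjv : padicValNat p Φ = j := by rw [hj, padicValNat.prime_pow]
    have hj1 : j ≤ 1 := by omega
    have hΦle : Φ ≤ p := by
      rw [hj]
      calc p ^ j ≤ p ^ 1 := Nat.pow_le_pow_right hp.pos hj1
        _ = p := pow_one p
    have hple : p ≤ Q - 1 := Nat.le_of_dvd (by omega) hpQ
    omega
  refine ⟨hnot, ?_⟩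
  have hQ1supp : ∀ d : ℕ, d.Prime → d ∣ Q - 1 → d = 2 := by
    intro d hd hdQ
    have : d ∣ 2 ^ k * p ^ m := hΦ ▸ hdQ.mul_right Φ
    rcases (Nat.Prime.dvd_mul hd).mp this with h2 | hpm
    · exact (Nat.prime_dvd_prime_iff_eq hd Nat.prime_two).mp (hd.dvd_of_dvd_pow h2)
    · have := (Nat.prime_dvd_prime_iff_eq hd hp).mp (hd.dvd_of_dvd_pow hpm)
      subst this
      exact absurd hdQ hnot
  obtain ⟨s, hs⟩ : ∃ s, Q - 1 = 2 ^ s := ⟨_, Nat.eq_prime_pow_of_unique_prime_dvd (by omega) (hQ1supp _)⟩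
  exact ⟨s, by omega⟩

/-- `Q^t = 2^s + 1` with `Q ≥ 3` odd and `t ≥ 2` forces `(Q, t) = (3, 2)`. -/
private theorem pow_eq_two_pow_add_one {Q t s : ℕ} (hQ : Odd Q) (hQ3 : 3 ≤ Q) (ht : 2 ≤ t)
    (h : Q ^ t = 2 ^ s + 1) : Q = 3 ∧ t = 2 := by
  rcases Nat.even_or_odd t with ⟨u, rfl⟩ | hto
  · -- `t = 2u`: `(Q^u - 1)(Q^u + 1) = 2^s`
    have hu : 1 ≤ u := by omega
    obtain ⟨X, hX⟩ : ∃ X, X = Q ^ u := ⟨_, rfl⟩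
    have hXodd : X % 2 = 1 := by rw [hX]; exact Nat.odd_iff.mp hQ.pow
    have hX3 : 3 ≤ X := by
      rw [hX]
      calc 3 ≤ Q := hQ3
        _ = Q ^ 1 := (pow_one Q).symm
        _ ≤ Q ^ u := Nat.pow_le_pow_right (by omega) hu
    have hXX : X * X = 2 ^ s + 1 := by rw [hX, ← pow_two, ← pow_mul, ← h]; ring_nf
    have hprod : (X - 1) * (X + 1) = 2 ^ s := by
      have h1 : 1 ≤ X := by omega
      zify [h1] at hXX ⊢
      linear_combination hXX
    obtain ⟨i, -, hi⟩ := (Nat.dvd_prime_pow Nat.prime_two).mp (Dvd.intro _ hprod)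
    obtain ⟨j, -, hj⟩ := (Nat.dvd_prime_pow Nat.prime_two).mp (Dvd.intro_left _ hprod)
    -- `2^j = 2^i + 2` forces `i = 1`, `j = 2`, `X = 3`
    have hX3' : X = 3 := by
      rcases i with _ | _ | i
      · simp at hi; omega
      · simp at hi; omega
      · rcases j with _ | _ | j
        · simp at hj; omega
        · simp at hj; omega
        · have h4i : 4 ∣ X - 1 := hi ▸ Dvd.intro (2 ^ i) (by ring)
          have h4j : 4 ∣ X + 1 := hj ▸ Dvd.intro (2 ^ j) (by ring)
          omega
    -- `Q^u = 3` forces `u = 1`, `Q = 3`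
    rcases u with _ | _ | u
    · omega
    · simp at hX
      exact ⟨hX ▸ hX3', by omega⟩
    · exfalso
      have h9 : 9 ≤ Q ^ 2 := by nlinarith
      have : Q ^ 2 ≤ X := hX ▸ Nat.pow_le_pow_right (by omega) (by omega)
      omega
  · -- `t` odd `≥ 3`: `Q^t - 1 = (Q - 1) G` with `G` odd `> 1` dividing `2^s`
    exfalso
    have ht3 : 3 ≤ t := by obtain ⟨r, hr⟩ := hto; omega
    set G := ∑ i ∈ Finset.range t, Q ^ i with hGdef
    have hG : (Q - 1) * G = 2 ^ s := by rw [hGdef, geomSum_mul (by omega), h]; simp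
    have hGodd : G % 2 = 1 := by rw [hGdef, geomSum_mod_two hQ]; exact Nat.odd_iff.mp hto
    have hGbig : Q + 1 ≤ G := by
      have : ∑ i ∈ Finset.range 2, Q ^ i ≤ G :=
        Finset.sum_le_sum_of_subset (Finset.range_subset_range.mpr (by omega))
      simpa [Finset.sum_range_succ, add_comm] using this
    obtain ⟨i, -, hi⟩ := (Nat.dvd_prime_pow Nat.prime_two).mp (Dvd.intro_left _ hG)
    rcases i with _ | i
    · simp at hi; omega
    · have : 2 ∣ G := hi ▸ Dvd.intro (2 ^ i) (by ring)
      omega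

/-- `b^(2ℓ) - 1 = 2^k p^m` is impossible for `b ≥ 3` odd, `ℓ ≥ 3` odd and `p` an odd prime: the odd parts of
`b^ℓ - 1` and `b^ℓ + 1` are `> 1`, coprime, and would both be powers of `p`. -/
private theorem sq_pow_corner {k m ℓ p b : ℕ} (hp : p.Prime) (hp2 : p ≠ 2) (hb : Odd b) (hb3 : 3 ≤ b)
    (hℓ : Odd ℓ) (hℓ3 : 3 ≤ ℓ) (h : 2 ^ k * p ^ m + 1 = (b ^ ℓ) ^ 2) : False := by
  obtain ⟨h', hℓh⟩ : ∃ h', ℓ = 2 * h' + 1 := hℓ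
  have hh1 : 1 ≤ h' := by omega
  have hbℓ : 3 ≤ b ^ ℓ :=
    calc 3 ≤ b := hb3
      _ = b ^ 1 := (pow_one b).symm
      _ ≤ b ^ ℓ := Nat.pow_le_pow_right (by omega) (by omega)
  have hfac : (b ^ ℓ - 1) * (b ^ ℓ + 1) = 2 ^ k * p ^ m := by
    have h1 : 1 ≤ b ^ ℓ := by omega
    zify [h1] at h ⊢
    linear_combination -h
  -- the odd part `G` of `b^ℓ - 1`
  set G := ∑ i ∈ Finset.range ℓ, b ^ i with hGdef
  have hG : (b - 1) * G = b ^ ℓ - 1 := by rw [hGdef, geomSum_mul (by omega)]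
  have hGodd : G % 2 = 1 := by rw [hGdef, geomSum_mod_two hb, hℓh]; omega
  have hGbig : b + 1 ≤ G := by
    have : ∑ i ∈ Finset.range 2, b ^ i ≤ G :=
      Finset.sum_le_sum_of_subset (Finset.range_subset_range.mpr (by omega))
    simpa [Finset.sum_range_succ, add_comm] using this
  have hGd : G ∣ 2 ^ k * p ^ m := by
    rw [← hfac, ← hG]
    exact Dvd.intro_left ((b - 1) * (b ^ ℓ + 1)) (by ring)
  have hpG : p ∣ b ^ ℓ - 1 := (dvd_of_odd_dvd_two_pow_mul hp hGodd (by omega) hGd).trans (Dvd.intro_left _ hG)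
  -- the odd part `Ψ = (b-1) b S + 1` of `b^ℓ + 1`, `S = 1 + b² + ⋯ + (b²)^(h'-1)`
  set S := ∑ i ∈ Finset.range h', (b ^ 2) ^ i with hSdef
  have hb2le : 2 ≤ b ^ 2 := by nlinarith
  have hS : (b ^ 2 - 1) * S = (b ^ 2) ^ h' - 1 := by rw [hSdef, geomSum_mul hb2le]
  have hS1 : 1 ≤ S := by
    have : ∑ i ∈ Finset.range 1, (b ^ 2) ^ i ≤ S :=
      Finset.sum_le_sum_of_subset (Finset.range_subset_range.mpr hh1)
    simpa using this
  set Ψ := (b - 1) * b * S + 1 with hΨdef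
  have hΨ : (b + 1) * Ψ = b ^ ℓ + 1 := by
    rw [hℓh, hΨdef]
    have h1 : 1 ≤ (b ^ 2) ^ h' := Nat.one_le_pow _ _ (by positivity)
    have h2 : 1 ≤ b ^ 2 := by omega
    have h3 : 1 ≤ b := by omega
    zify [h1, h2, h3] at hS ⊢
    linear_combination (b : ℤ) * hS
  have hΨodd : Ψ % 2 = 1 := by
    have h2 : 2 ∣ (b - 1) * b * S := by
      have : 2 ∣ b - 1 := by
        have := Nat.odd_iff.mp hb
        omega
      exact (this.mul_right b).mul_right S
    omega
  have hΨbig : b + 2 ≤ Ψ := by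
    have h6 : (b - 1) * b * 1 ≤ (b - 1) * b * S := Nat.mul_le_mul_left _ hS1
    rw [mul_one] at h6
    have h5 : b + 1 ≤ (b - 1) * b := by
      obtain ⟨t, rfl⟩ : ∃ t, b = t + 1 := ⟨b - 1, by omega⟩
      rw [Nat.add_sub_cancel]
      nlinarith
    omega
  have hΨd : Ψ ∣ 2 ^ k * p ^ m := by
    rw [← hfac, ← hΨ]
    exact Dvd.intro_left ((b ^ ℓ - 1) * (b + 1)) (by ring)
  have hpΨ : p ∣ b ^ ℓ + 1 := (dvd_of_odd_dvd_two_pow_mul hp hΨodd (by omega) hΨd).trans (Dvd.intro_left _ hΨ)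
  -- `p` divides `(b^ℓ + 1) - (b^ℓ - 1) = 2`
  have h2 : p ∣ 2 := by
    have : b ^ ℓ + 1 = (b ^ ℓ - 1) + 2 := by omega
    rw [this] at hpΨ
    exact (Nat.dvd_add_right hpG).mp hpΨ
  exact hp2 ((Nat.prime_dvd_prime_iff_eq hp Nat.prime_two).mp h2)

/-- `8 ∣ n` is impossible in `2^k p^m + 1 = q^n` (`q ≥ 3` odd, `p` prime): `(q²+1)/2` and `(q⁴+1)/2` are odd, coprime,
`> 1` and both divide `q^n - 1`. -/
private theorem eight_dvd_corner {k m n p q : ℕ} (hp : p.Prime) (hq : Odd q) (hq3 : 3 ≤ q) (h8 : 8 ∣ n)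
    (h : 2 ^ k * p ^ m + 1 = q ^ n) : False := by
  have hqn : q ^ n - 1 = 2 ^ k * p ^ m := by omega
  have hdvd : q ^ 8 - 1 ∣ 2 ^ k * p ^ m := by
    rw [← hqn]; simpa using Nat.pow_sub_pow_dvd_pow_sub_pow q 1 h8
  have hq4 : q ^ 2 % 4 = 1 := by
    obtain ⟨r, rfl⟩ := hq
    have : (2 * r + 1) ^ 2 = 4 * (r * r + r) + 1 := by ring
    omega
  have hq44 : q ^ 4 % 4 = 1 := by
    rw [Nat.pow_mod]
    have : q % 4 = 1 ∨ q % 4 = 3 := by obtain ⟨r, rfl⟩ := hq; omega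
    rcases this with h4 | h4 <;> rw [h4]
  obtain ⟨W, hW⟩ : ∃ W, q ^ 2 + 1 = 2 * W := ⟨(q ^ 2 + 1) / 2, by omega⟩
  obtain ⟨Z, hZ⟩ : ∃ Z, q ^ 4 + 1 = 2 * Z := ⟨(q ^ 4 + 1) / 2, by omega⟩
  have hWodd : W % 2 = 1 := by omega
  have hZodd : Z % 2 = 1 := by omega
  have hq29 : 9 ≤ q ^ 2 := by nlinarith
  have hW1 : 1 < W := by omega
  have hZ1 : 1 < Z := by have : q ^ 2 ≤ q ^ 4 := Nat.pow_le_pow_right (by omega) (by omega); omega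
  -- `Z = W (q² - 1) + 1`
  have hZW : Z = W * (q ^ 2 - 1) + 1 := by
    have h1 : 1 ≤ q ^ 2 := by omega
    have key : 2 * Z = 2 * (W * (q ^ 2 - 1) + 1) := by
      rw [← hZ]
      have hq4' : q ^ 4 = q ^ 2 * q ^ 2 := by ring
      rw [hq4']
      zify [h1] at hW ⊢
      linear_combination ((q : ℤ) ^ 2 - 1) * hW
    omega
  -- both divide `q^8 - 1`
  have h81 : q ^ 8 - 1 = 2 * W * ((q ^ 2 - 1) * (2 * Z)) := by
    rw [← hW, ← hZ]
    have h1 : 1 ≤ q ^ 2 := by omega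
    have h8 : 1 ≤ q ^ 8 := Nat.one_le_pow _ _ (by omega)
    zify [h1, h8]
    ring
  have hWd : W ∣ 2 ^ k * p ^ m :=
    (Dvd.intro_left 2 rfl |>.trans (Dvd.intro _ h81.symm)).trans hdvd
  have hZd : Z ∣ 2 ^ k * p ^ m := by
    refine (?_ : Z ∣ q ^ 8 - 1).trans hdvd
    rw [h81]
    exact Dvd.intro_left (2 * W * ((q ^ 2 - 1) * 2)) (by ring)
  have hpW : p ∣ W := dvd_of_odd_dvd_two_pow_mul hp hWodd hW1 hWd
  have hpZ : p ∣ Z := dvd_of_odd_dvd_two_pow_mul hp hZodd hZ1 hZd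
  have : p ∣ 1 := by
    rw [hZW] at hpZ
    exact (Nat.dvd_add_right (hpW.mul_right _)).mp hpZ
  exact hp.one_lt.ne' (Nat.dvd_one.mp this)

/-- **Shape C: the exponent is `1`, `2`, `4` or an odd prime.** If `p, q` are odd primes and `2^k p^m + 1 = q^n`, then
`n = 1`, `n = 2`, `n = 4`, or `n` is an odd prime and `q = 2^s + 1` is a Fermat-type prime.  (No Zsigmondy.) -/
theorem shapeC_exponent {k m n p q : ℕ} (hp : p.Prime) (hq : q.Prime) (hp2 : p ≠ 2) (hq2 : q ≠ 2)
    (h : 2 ^ k * p ^ m + 1 = q ^ n) :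
    n = 1 ∨ n = 2 ∨ n = 4 ∨ (n.Prime ∧ n ≠ 2 ∧ ∃ s : ℕ, q = 2 ^ s + 1) := by
  have hq3 : 3 ≤ q := by have := hq.two_le; omega
  have hqodd : Odd q := hq.odd_of_ne_two hq2
  have hn0 : n ≠ 0 := by
    rintro rfl
    rw [pow_zero] at h
    have : 1 ≤ 2 ^ k * p ^ m :=
      Nat.one_le_iff_ne_zero.mpr (Nat.mul_ne_zero (pow_ne_zero k two_ne_zero) (pow_ne_zero m hp.ne_zero))
    omega
  by_cases H : ∃ ℓ, ℓ.Prime ∧ ℓ ≠ 2 ∧ ℓ ∣ n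
  · obtain ⟨ℓ, hℓ, hℓ2, t, rfl⟩ := H
    have ht : 1 ≤ t := by
      rcases t with _ | t
      · simp at hn0
      · omega
    have h' : 2 ^ k * p ^ m + 1 = (q ^ t) ^ ℓ := by rw [h, mul_comm, pow_mul]
    have hQ3 : 3 ≤ q ^ t :=
      calc 3 ≤ q := hq3
        _ = q ^ 1 := (pow_one q).symm
        _ ≤ q ^ t := Nat.pow_le_pow_right (by omega) ht
    obtain ⟨-, s, hs⟩ := pow_odd_prime_corner hp hℓ hp2 hℓ2 hqodd.pow hQ3 h'
    rcases Nat.lt_or_ge t 2 with ht1 | ht2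
    · have : t = 1 := by omega
      subst this
      refine Or.inr (Or.inr (Or.inr ⟨by simpa using hℓ, by simpa using hℓ2, s, by simpa using hs⟩))
    · exfalso
      obtain ⟨rfl, rfl⟩ := pow_eq_two_pow_add_one hqodd hq3 ht2 hs
      have h9 : 2 ^ k * p ^ m + 1 = (3 ^ ℓ) ^ 2 := by rw [h, pow_mul]
      exact sq_pow_corner hp hp2 (by decide) (le_refl 3) (hℓ.odd_of_ne_two hℓ2)
        (by have := hℓ.two_le; omega) h9
  · -- every prime factor of `n` is `2`: `n = 2^e` with `e ≤ 2`
    push Not at H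
    have hn2 : ∀ d : ℕ, d.Prime → d ∣ n → d = 2 := by
      intro d hd hdn
      by_contra hne
      exact H d hd hne hdn
    obtain ⟨e, he⟩ : ∃ e, n = 2 ^ e := ⟨_, Nat.eq_prime_pow_of_unique_prime_dvd hn0 (hn2 _)⟩
    rcases Nat.lt_or_ge e 3 with h3 | h3
    · interval_cases e <;> simp [he]
    · exfalso
      have h8 : 8 ∣ n := by
        rw [he]
        exact (pow_dvd_pow 2 h3 : 2 ^ 3 ∣ 2 ^ e)
      exact eight_dvd_corner hp hqodd hq3 h8 h

end Summit.ABC.ABC.Theorems
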